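import Mathlib
import HarnessLib
import HarnessLib.Audit
import Summits.PneNP.Statement
import Literature.Computability.Complexity.CNF
import Literature.Computability.MetaComplexity.Resolution
import Literature.Computability.MetaComplexity.ProofSystems
import Literature.Computability.Complexity.CookBridges
import Literature.Computability.Complexity.TautMachine
import Literature.Computability.MetaComplexity.ProofSystemsProofs
import Summits.PneNP.PneNP.Theorems.ExpanderLinearGeneratorsTautBridge
import HarnessLib.Audit.Status.Attr

/-!
Route: LyapunovRefutations

# Route LyapunovRefutations — refutations as Lyapunov functions — polyhedral path-complete
certificates for Tsitsiklis–Blondel switched systems as a Cook–Reckhow ladder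

It suffices to show X: TAUT has no polynomially bounded Cook–Reckhow proof system (equivalently
UNSAT has no p-bounded
refutation system; equivalently NP ≠ coNP). Card realised: lyapunov-refutations-switched-unsat. The
card's reading of X:
by Tsitsiklis–Blondel (TsitsiklisBlondel1997, Thm 1) φ ↦ (A₀(φ), A₁(φ)) sends UNSAT CNFs exactly to
stable pairs of 0/1 matrices
with margin (ρ^(n+2) ≤ m−1 vs ≥ m), so every polynomial-time verifiable, sound and complete class of
STABILITY CERTIFICATES
(Lyapunov functions: common polyhedral, path-complete polyhedral, SOS, …) is a Cook–Reckhow system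
for UNSAT, and X says that no
such class is polynomially bounded. The route attacks X from below by class-by-class lower bounds
(rungs) stated over a new,
self-contained object — the LAYERED MAX-LINEAR CERTIFICATE of a CNF, which is the layer-by-layer
restriction of a polyhedral
path-complete Lyapunov function (AthanasopoulosJungers2019, AhmadiEtAl2014) of the
Tsitsiklis–Blondel pair — and by locating
that object inside ordered proof complexity. The rungs do not imply X; the deciding theorem `closes
(h₀ : NoPolyBoundedTautProofs) : PneNP` derives Cook's statement from X alone, in-file, over
conjecture-free modules (CookBridges, TautMachine, ProofSystemsProofs).
Lean: `¬ Literature.Computability.MetaComplexity.HasPolyBoundedProofSystem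
Literature.Computability.Complexity.TAUT`

## Assembly
The deciding theorem is `closes (h₀ : NoPolyBoundedTautProofs) : PneNP` (glue.lean, certified; cone
repair 2026-08-16): if Classes.P = NP
then coNP = co P = P = NP (co_P_holds), so TAUT ∈ coNP (TAUT_mem_coNP_holds) lies in NP and has a
polynomially bounded proof system
(hasPolyBoundedProofSystem_iff_mem_NP_holds, Cook–Reckhow Prop. 1.4), contradicting X; and Classes.P
≠ NP is Cook's statement by
pneNP_shape_of_P_ne_NP (CookBridges: p_bool_eq, np_bool_eq, P_subset_NP_holds). The shared support
TautBridge (stmt-PneNP-10249, PROVED,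
still wanted by ExpanderLinearGenerators / AperiodicTorus / MatroidTseitin) was dropped from this
route on 2026-08-16: its proof module
(Theorems/ExpanderLinearGeneratorsTautBridge) imports ClayProblem and ProofComplexityNP and so put
the unproved named facts NPNotSubsetPPoly,
EFNotPolyBounded, MurrayWilliams2018_NQP_not_ACC and MurrayWilliams2018_NTIME_not_depth_ACC into the
route's import cone although no item
uses any of them (ledger deps: 0 unproved constants). The item Assembly (stmt-PneNP-15155,
superseding stmt-PneNP-14057 with the same meaning; `NoPolyBoundedTautProofs → _root_.PneNP`)
is literally the type of `closes`: PROVERS — close it by `theorem … : Assembly :=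
Summit.PneNP.PneNP.Theses.LyapunovRefutations.closes` in a Theorems file
importing ONLY this route file (cone hygiene: do NOT import
Theorems/ExpanderLinearGeneratorsTautBridge, ClayProblem, NPBridge,
ClayProblemProofs or ProofComplexityNP — each re-imports an unproved named fact and de-staffs the
route). The rungs (ranks 2–4 and the informal SOS rung filed after open) are unconditional theorems
about explicit linear maps;
none is claimed to imply X — they are the ladder under X on the single instance family of
Tsitsiklis–Blondel pairs, exactly as
Frege/EF lower bounds are rungs under X in route ProofCplx.

Rationale: WHY THIS LINE. Dictionary (TsitsiklisBlondel1997 proof of Thm 1, read as a proof system): the TB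
dynamics reads the assignment once in the fixed
variable order; restricted to vectors supported on one layer, a polyhedral (max of linear copositive
pieces, MasonShorten2007)
node function of a path-complete graph Lyapunov function (AhmadiEtAl2014; polyhedral templates
AthanasopoulosJungers2019) becomes
a max of linear forms in (σ, t) ∈ ℚ × ℚ^m (σ = mass already counted as satisfied, t_i = token of
clause i), reading x_j := b is the
linear map T_(j,b) merging the tokens of the clauses containing the literal (j,b) into σ, and the
Lyapunov inequalities become —
REPAIRED at rev 2 after the refutation of the look-ahead class — those of a FORWARD-COMPLETE
labelled graph (AhmadiEtAl2014 Prop. 3.3 (i)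
and Cor. 3.4, the checkable sufficient condition for path-completeness): a root exists, and EVERY
node at layer j has, for EACH letter b,
a b-successor at layer j+1 each of whose pieces pulled back by T_(j,b) is dominated on the orthant
by the node's max of pieces; leaves
dominate σ; roots are < m at (0, 𝟙). The class typed at rev 0 ('for every word SOME node path with
domination along it') let the path
look ahead and is certified for every unsatisfiable CNF by the m-node column certificate of
Theorems/LyapunovRefutationsPathCompletePHPLowerBoundRefutation.lean (path-completeness of that
graph is UNSAT itself, so it was not a
Cook–Reckhow system); the forward-complete class is one (successors listed, one LP per edge and
piece), it is sound (LayeredCertSound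
via the causal node path — Lean-checked in the planner sketch) and complete (LayeredCertComplete's
one-node certificate is
forward-complete), WLOG deterministic (keep one successor per letter) = an ordered read-once
branching skeleton whose nodes carry
max-linear potentials, and by backward induction every node majorises the Bellman value function of
its layer on the whole orthant —
exactly what the column nodes (1, 𝟙 − e_C) fail at middle layers (dead end at the letter satisfying
C). Into it ordered regular
resolution embeds (OrderedResolutionUpperBoundFC: pieces 𝟙 − e_C). Imported from control theory: the
certificate classes themselves
(common vs path-complete polyhedral vs SOS Lyapunov functions; AhmadiEtAl2014 Cor. 3.4/3.5: complete
graphs give min-of-node-functions,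
co-complete graphs give max — and the co-complete twin collapses here, by taking the max over the
nodes of a layer, to the one-node
class of rank 4), their converse theorems (completeness with size bounds) and the template ordering
by lifts
(doi:10.1016/j.nahs.2022.101237) as candidate p-simulations; imported from proof complexity:
Haken-type lower bounds (Haken1985, in
tree) and the Cook–Reckhow frame (CookReckhow1979). What prior routes do not do: ProofCplx/Proofcplx
attack X at Frege/EF or via
Krajíček generators; this line produces a new LP-verifiable system strictly motivated by stability
certificates, whose first rungs
(PHP for common and for forward-complete polyhedral certificates; resolution simulation) are
concrete finite combinatorics about
explicit linear maps, and whose outcome either way is a first Boolean-regime "complexity of Lyapunov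
functions" theorem
(AhmadiJungers2016 is the fixed-dimension, analytic regime). The negatives index now holds the
route's own settled edge
(PathCompletePHPLowerBound, look-ahead class, refuted by the column certificate); the repaired items
evade that witness because
forward-completeness forbids dead ends, and every rung keeps an explicit size floor c^n with c > 1,
non-vacuous by LayeredCertComplete /
OrderedResolutionUpperBoundFC. ROUTE-CHOICE (2026-08-16, after the SUBSTANTIVE refutation of the
look-ahead PHP rung stmt-PneNP-10247 and the refuters' located
counting lead against the forward-complete PHP rungs — rattack-10888 on stmt-PneNP-10888: fractional
compression of the PHP Bellman targets at the
boundary layers by 4n+2 resp. 13n+3 signed lines, verified n ≤ 6, conjecturally iterable to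
poly(n)): the line continues in the forward-complete
class on TWO instance families — PHP^(n+1)_n (ranks 2–4; counting-sensitive: AtseriasLauria2018) and
the Tseitin contradiction of the explicit
n × n torus (rank 6; parity — the blind spot of linear/convex counting: Grigoriev's linear
Positivstellensatz-calculus degree bound for the
parity, TCS 2001; DantchevRiis2001 for resolution on the grid) — so that a counting refutation of
the PHP rungs re-grades the ladder instead of
emptying it; `closes` concludes PneNP from X alone (cone repair 2026-08-16: the Cook–Reckhow / model
bridge is proved inside `closes` over
conjecture-free modules; TautBridge and Assembly are no longer items of this route).

RANKED CRUXES. #0 NoPolyBoundedTautProofs (target) — no Cook–Reckhow proof system for TAUT is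
polynomially bounded (⇔ NP ≠ coNP; ⇔ no refutation system for UNSAT, in particular no
stability-certificate class for Tsitsiklis–Blondel pairs, is p-bounded). Same signature as
ProofCplx's thesis item; shared on purpose. (why it might fail: false iff SOME proof system, however
unnatural, is p-bounded (NP = coNP); no superpolynomial lower bound is known for any system from
Frege up (KrajicekProofComplexity2019 Problem 1.5.3).) [CookReckhow1979,
KrajicekProofComplexity2019, TsitsiklisBlondel1997]
#2 LayeredCertToResolutionFC (crux; supersedes LayeredCertToResolution, which the column certificate
+ haken_pigeonhole_holds refute as typed) — LOCATE THE FORWARD-COMPLETE POLYHEDRAL CLASS (card K1b):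
there is k such that every forward-complete layered max-linear certificate (N, P) of a CNF φ — root
0 < N 0, forward-completeness-with-domination (FC), leaf condition (L2), root condition (L3) —
yields a resolution refutation of φ of length ≤ (Σ pieces + size φ + |φ| + 2)^k. I.e. fractional
pieces on an ordered read-once skeleton buy at most a polynomial over regular / ordered resolution;
then every resolution lower bound in the tree (haken_pigeonhole_holds; Tseitin, random k-CNF)
becomes a lower bound on forward-complete polyhedral Lyapunov certificates of TB pairs. [difficulty:
L] (why it might fail: even with nonnegative pieces a node is a covering state — a SET of candidate
falsified clauses, a DNF-like line — so the natural simulation is by Res(k), k = O(1) unclear;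
signed pieces may add Sherali–Adams-type counting (AtseriasLauria2018 Thm 7/9) and then PHP makes
the item false via haken_pigeonhole_holds.) [KrajicekProofComplexity2019, Haken1985, AhmadiEtAl2014,
AtseriasLauria2018, Jukna2012]
#3 PathCompletePHPLowerBoundFC (crux; supersedes the refuted PathCompletePHPLowerBound) — FIRST
BOOLEAN-REGIME LOWER BOUND (card K2): there is c > 1 such that for every n every forward-complete
layered max-linear certificate for PHP^(n+1)_n (pigeonholeCNF (n+1) n, canonical variable order
x_(ij) = i·n + j) has total piece count ≥ c^n; equivalently every polyhedral path-complete Lyapunov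
function on a forward-complete graph certifying ρ(A₀,A₁)^(n+2) < m for the Tsitsiklis–Blondel pair
of PHP has ≥ c^n (nodes × pieces)/(n+2). Implies #4 (N ≡ 1 is forward-complete; implication
Lean-checked in the planner sketch) and follows from #2 + haken_pigeonhole_holds; intended direct
proof: Haken/Beame–Pitassi bottleneck counting over the deterministic skeleton against fractional
node potentials, using the metric chain condition and not only supports (refuter notes LYAP_note.md,
LyapunovOneNodeNumerics.md on stmt-PneNP-10248). [difficulty: L] (why it might fail: signed rational
pieces with convex domination may count: PHP^(n+1)_n has poly-size circular-resolution ≡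
Sherali–Adams refutations (AtseriasLauria2018 Thm 9, Thm 7); a read-once layering of that flow proof
in the order x_(ij) = i·n + j as node potentials would give poly(n) certificates.) [Haken1985,
AhmadiEtAl2014, AtseriasLauria2018, TsitsiklisBlondel1997, Jukna2012]
#4 CommonLyapunovPHPLowerBound (crux, unchanged; not hit by the column witness since one node takes
both letters) — COMMON POLYHEDRAL LYAPUNOV FUNCTIONS (one node per layer = a single max-of-linear
copositive Lyapunov function of the TB pair, MasonShorten2007 / Molchanov–Pyatnitskiy class; also =
the co-complete class after taking the max over nodes): there is c > 1 such that every
one-node-per-layer layered max-linear certificate for PHP^(n+1)_n has ≥ c^n pieces. Special case of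
rank 3 (N ≡ 1). [difficulty: M, optimistic per refuters] (why it might fail: if all σ-coefficients
are 1 the supports {i : c_i < 1} give a read-once BP for Search(PHP) and Haken yields c^n, but
pieces with a ≠ 1 or negative entries may give a fractional poly(n) certificate; fractional savings
already appear at n = 2 (40 vs 44 pieces).) [MasonShorten2007, TsitsiklisBlondel1997, Haken1985,
Jukna2012, AhmadiJungers2016]
#6 PathCompleteTseitinLowerBoundFC (crux; PARITY RUNG, added at the route-choice) — for every n ≥ 2,
every forward-complete layered max-linear certificate (verbatim hypothesis block of ranks 2/3) of
tseitinCNF(T_n, χ₀) — T_n the n × n torus on Fin (n·n) (p ↦ (p / n, p % n); edges to (r, c ± 1 mod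
n), (r ± 1 mod n, c); SimpleGraph.fromRel of that arithmetic relation; 4-regular for n ≥ 3), χ₀ the
odd charge at vertex 0, edge variables numbered by tseitinEdgeVar and read in index order — has
total piece count ≥ c^n for one absolute c > 1. Integral sub-case: 0/1 FC certificates are ordered
read-once BPs for Search(Tseitin), here of size 2^Θ(n)·n^4 (frontier = one row + the n column-wrap
edges; KrajicekProofComplexity2019 Thm 5.3.1, DantchevRiis2001), so c^n is the true order; the
content is what signed fractional pieces save against PARITY. N ≡ 1 is the first step; non-vacuous
by LayeredCertComplete (odd charge); n = 0, 1 excluded (n = 1 gives [[]], one piece); for n ≥ 2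
every certificate has ≥ numVars + 1 ≥ 13 pieces, so only an infinite subexponential family refutes.
[difficulty: L] (why it might fail: alive clause tokens at a vertex linearly encode its read edge
values and magnitudes are free, so poly(n) signed forms per layer might majorise the parity Bellman
loss F + [F even] without a 2^n-wide skeleton; statics give no bound even for N ≡ 1; no SA-size
bound is known for GRID Tseitin; and Tseitin has quasi-polynomial cutting-planes refutations
(DadushTiwari2020) — though by branching on integer linear forms, which a fixed-order
single-variable skeleton cannot do.) [Urquhart1987, DantchevRiis2001, KrajicekProofComplexity2019,
AhmadiEtAl2014, AtseriasLauria2018, DadushTiwari2020]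
#1 Assembly (assembly; stmt-PneNP-15155, superseding stmt-PneNP-14057 with the same meaning;
`NoPolyBoundedTautProofs → _root_.PneNP`) — literally the type of the deciding theorem; provable now
by `Summit.PneNP.PneNP.Theses.LyapunovRefutations.closes` in a Theorems file importing ONLY this
route file (cone hygiene, see below). [difficulty: provable-now] [CookReckhow1979, AroraBarakCC2009]
(dropped 2026-08-16, cone repair) TautBridge (support; PROVED by
Summit.PneNP.PneNP.Theorems.tautBridge_proof; shared with ExpanderLinearGenerators / AperiodicTorus
/ MatroidTseitin) — no longer an item here: its proof module drags Theses/ExpanderLinearGenerators,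
ClayProblem, ProofComplexity and CircuitLowerBounds (4 unproved named facts, none used by any item)
into the import cone; the same mathematics (if P = NP then coNP = co P = P ⊆ NP, so TAUT ∈ NP has a
p-bounded proof system, Cook–Reckhow Prop. 1.4; Classes.P ≠ NP ⇒ Cook's statement by the Wave0
bridges) is now the body of `closes` over CookBridges / TautMachine / ProofSystemsProofs (import
cone 39 project modules, no unproved named fact). Provers of Assembly or of anything else in this
route must NOT import Theorems/ExpanderLinearGeneratorsTautBridge, ClayProblem, NPBridge,
ClayProblemProofs or ProofComplexityNP. A clean re-homing of tautBridge_proof over the same three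
modules would serve the sibling routes; recipe attached as evidence on stmt-PneNP-10249.
[CookReckhow1979, AroraBarakCC2009]
#9 LayeredCertSound (support) — SOUNDNESS of the (wider) look-ahead class, hence of the
forward-complete class through the causal path p(j+1) = succ(j, p j, w j): a certificate of φ exists
only if φ is unsatisfiable (run the satisfying word from (0, 𝟙); leaf piece ≥ m pulls back to a root
piece ≥ m at (0, 𝟙), contradicting (L3)). Candidate proof attached (LREvidence.lean). [difficulty:
provable-now] [TsitsiklisBlondel1997, AhmadiEtAl2014]
#9 LayeredCertComplete (support) — COMPLETENESS: every unsatisfiable φ has a one-node-per-layer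
certificate with pieces (1, w^β) over assignments β of the unread variables (the Bellman value
function; TB's brute-force certificate); one-node certificates are forward-complete, so this guards
every repaired rung against vacuity. Candidate proof attached (LCComplete.lean). [difficulty:
provable-now] [TsitsiklisBlondel1997, AhmadiEtAl2014]
#9 OrderedResolutionUpperBoundFC (support; supersedes OrderedResolutionUpperBound, which the column
certificate made contentless) — ORDERED RESOLUTION EMBEDS INTO THE FORWARD-COMPLETE CLASS (card
K1a): a resolution refutation π of φ whose pivots strictly increase along every
conclusion-to-premise dag path (= an ordered read-once branching program for clause search reading
x_0 first) yields a FORWARD-COMPLETE certificate with ≤ (|π|+1)(numVars+1)(m+1) pieces: node = line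
D at layer pivot(D) with copies on the skipped layers (both letters lead a copy to the next copy),
the b-successor of D is the premise containing the literal (pivot(D), ¬b), initial clauses continue
by copies to layer numVars; pieces (1, 𝟙 − e_C) for the initial clauses C below D; domination
audited TRUE on paper by refuter rreview-0815T15-10 (details in the item docstring). [difficulty: M]
[KrajicekProofComplexity2019, Haken1985, Jukna2012, AhmadiEtAl2014]

TWO-LAYER PLAN. Foreseen glued splits (nothing filed now): LayeredCertToResolutionFC ⇐ (normal form:
deterministic skeleton, pieces (a,u) with a = 1 after rescaling where possible; integrality: along
every edge the dominating convex combination can be taken 0/1 with polynomial loss) → (0/1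
forward-complete certificates are ordered read-once BPs for clause search = regular ordered
resolution, Jukna2012 §18.2) → LayeredCertToResolutionFC; PathCompletePHPLowerBoundFC ⇐ (bottleneck
lemma: at layer n(n+1)/2 every skeleton node reached by a critical partial matching carries a piece
whose sign pattern determines the occupied-hole set up to o(n) holes, via the chain condition
Z(Q_(j+1)) ⊆ Q_j + ℝ^m_+) → (counting) → PathCompletePHPLowerBoundFC; CommonLyapunovPHPLowerBound ⇐
LP-duality normal form of one-node certificates (concave loss chain D_j ≤ D_(j+1) ∘ Z_(j,b), D_0(𝟙)
> 0) → counting. PathCompleteTseitinLowerBoundFC ⇐ (N ≡ 1 for the torus by a DYNAMIC frontier lemma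
across the n layers closing one row — single-layer statics give nothing) → (skeleton case: pieces
cannot be shared between the 2^Ω(n) frontier-parity classes at a layer) → the item.

KILL CRITERIA. ¬NoPolyBoundedTautProofs (a p-bounded proof system for TAUT, i.e. NP = coNP) closes
the route outright (and every NP ≠ coNP route).
Refutation of PathCompletePHPLowerBoundFC or CommonLyapunovPHPLowerBound by explicit poly(n)
FORWARD-COMPLETE certificates (a genuine
counting construction, e.g. a read-once layering of the Atserias–Lauria flow proof or
rattack-10888's recursive compression) does NOT close the
route: it re-grades the ladder (polyhedral Lyapunov certificates escape ordered proof complexity by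
counting), kills LayeredCertToResolutionFC via
haken_pigeonhole_holds, and promotes the parity rung (rank 6, typed now) to lead rung; Tseitin on
explicit expanders (Gabber–Galil graphs on
ZMod m × ZMod m, definable like the torus) / random 3-XOR and a Sherali–Adams-type location crux
(needs SA as a Literature notion) are filed then.
Refutation of rank 6 AS WELL (subexponential forward-complete certificates for torus Tseitin: signed
pieces linearise parity without branching)
⇒ the forward-complete polyhedral class carries no lower bound we can locate: close the route
refuted (X stays with ProofCplx; the SOS rung
returns to the card). Refutation of rank 6 ALONE (PHP rungs standing) ⇒ drop rank 6 and record the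
parity upper bound under NUMBERS. A refutation by another TYPING
degeneracy (a data-free certificate valid for every unsatisfiable CNF) would mean the class is still
not the intended Cook–Reckhow system:
repair by the missing normalisation, not a pivot — the intended object is fixed by 'successors
listed, one LP per edge, every node
majorises the Bellman function'. Refutation of CommonLyapunovPHPLowerBound alone ⇒ drop rank 4, keep
2–3. If LayeredCertToResolutionFC
is PROVED, ranks 3–4 follow from haken_pigeonhole_holds and the route moves up to the SOS rung.
Proof of X elsewhere (ProofCplx) moots
the route.

NOT DECOMPOSED YET. The matrix side (definition requests filed after open: the Tsitsiklis–Blondel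
pair as Mathlib matrices, polyhedral path-complete
Lyapunov functions and the joint spectral radius) and the support statement 'polyhedral
path-complete Lyapunov function on a
forward-complete graph with N nodes, f facets, rate γ with γ^(n+2) < m ⇒ forward-complete layered
certificate with ≤ N(n+2) nodes and
≤ 2f pieces' (informal); the SOS / piecewise-quadratic rungs (card K3/K4; stmt-PneNP-10263 informal)
typed once the matrix definitions
land; 'every variable order' versions of ranks 3 and 6; Tseitin on explicit expanders (Gabber–Galil,
floor c^(m²)) and random 3-XOR; the
Sherali–Adams location crux ('s pieces, b-bit coefficients ⇒ an SA refutation of size poly(s,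
b)·2^O(frontier)?') once SA is a Literature notion; the identification of template ordering by lifts
with
p-simulation. NOT filed on purpose: the co-complete (backward-complete, AhmadiEtAl2014 Prop. 3.3
(ii)) twin — the max over the nodes
of a layer collapses it to the one-node class, so its PHP rung IS rank 4; general path-complete
graphs with path-completeness merely
promised are not a Cook–Reckhow class (universality of a layered NFA is coNP-complete — the lesson
of the refutation) and are not pursued.

CHEAPEST FALSIFIER. Small-instance search for ranks 4/3: for PHP^(n+1)_n, n = 2..4, canonical order
— rank 4: one node per layer, f pieces per layer;
rank 3: a deterministic skeleton with w nodes per layer and f pieces per node — solve the bilinear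
feasibility (alternate LPs in pieces /
multipliers, or MIP with big-M) and watch whether the minimum grows like 2^n or like n^2. Refuter
g40-63 ran rank 4 for n ≤ 3
(LyapunovOneNodeNumerics.md on stmt-PneNP-10248: integral optima 6 / 44 pieces at n = 1, 2, ≤ 387 at
n = 3; signed fractional pieces
already save at n = 2, 40 vs 44; farm job j001813 for n = 3 pending). Decisive paper falsifier
(grounder g18-18 lead): schedule the
Atserias–Lauria circular-resolution / Sherali–Adams flow refutation of PHP (AtseriasLauria2018 Thm
9: width d, built pigeon by pigeon)
read-once in the order x_(ij) = i·n + j as node potentials; success refutes ranks 2–4 together and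
triggers the Tseitin pivot. Cheapest now (rattack-10888's
recommendation): run the recursive compressor (EVIDENCE.md §5, check_php.py / compress_nm2.py on
stmt-PneNP-10888) on rank 4 first — it
decides ranks 2–4 together. Rank 6: the same alternating-LP / MIP search for one-node certificates
of torus Tseitin at n = 2, 3 (8 / 72 clauses,
numVars 12 / 72) and of 2 × k, 3 × k cylinders in the same edge order; watch 2^n versus poly.

NUMBERS. Tsitsiklis–Blondel margins: r = (n+1)(m+1) states; UNSAT ⇒ every product of n+2 factors has
max-row-sum ≤ m−1, SAT ⇒ some product
has spectral radius ≥ m (TsitsiklisBlondel1997 pp. 36–37), relative gap (m/(m−1))^(1/(n+2)) − 1 ≈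
1/((n+2)m). Haken: resolution size
≥ c^n for PHP^(n+1)_n (haken_pigeonhole_holds, in tree). Forward-complete certificate sizes:
completeness ≤ (n+1)·2^m pieces on one
node per layer; truth-table certificate 2^j nodes at layer j; ordered-resolution certificate ≤
(|π|+1)(n+1)(m+1) pieces; the column
certificate of the refuted look-ahead class has (numVars+1)·m ≤ 64 n^5 pieces for PHP and is NOT
forward-complete (node C has no
successor under the letter satisfying C). PHP²₁ needs exactly 6 pieces in the one-node class
(refuter hand proof). Fixed-dimension regime
(AhmadiJungers2016): for every d a stable pair with no polytopic Lyapunov function with ≤ d facets —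
orthogonal to the c^n-in-dimension
statements here. Torus Tseitin (Lean #eval): n = 2: 8 clauses, numVars 12 (C₄); n = 3: 72, 72; n =
4: 128, 240;
in general 8n² clauses (n ≥ 3), numVars ≤ n⁴, ordered-BP certificates with 2^O(n)·n⁴ pieces.
Items after the cone repair (2026-08-16): target, 4 typed cruxes (ranks 2–4, 6), 3 typed supports,
assembly (= type of `closes`), 2 informal; 1 settled
negative edge; deciding theorem `closes : NoPolyBoundedTautProofs → PneNP` proved in-file (import
cone 39 project modules, no unproved named fact).

DEFINITION REQUESTS. After open: (D1) `tsitsiklisBlondelPair : CNF ℕ → Matrix ι ι ℚ × Matrix ι ι ℚ`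
(TsitsiklisBlondel1997 §2, ι = s ⊕ clause×layer ⊕
layer) with the cycle identity A_w e_s = λ(q) e_s; (D2) polyhedral path-complete graph Lyapunov
function of a finite matrix family
with rate γ on a forward-complete graph (AhmadiEtAl2014 Def. 2.2–2.3, Prop. 3.3;
AthanasopoulosJungers2019) and `jointSpectralRadius`
over Mathlib matrix norms. Cite fact wanted: AJPR 2014 Thm 2.4 (path-complete ⇒ ρ ≤ γ).

Novelty: Searches (2026-08-15): `lit search --source crossref "complexity of Lyapunov functions for switched
linear systems"` (10: AhmadiJungers2016/IFAC 2014, copositive LFs, LP-based CLF computation — all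
control-internal); `lit search --source crossref "path-complete Lyapunov functions positive switched
systems copositive linear max-type"` (10: MasonShorten2007, Fornasini–Valcher 2010 — existence
criteria, no size lower bounds); `lit search --source crossref "path-complete graphs Lyapunov
functions memory De Bruijn ordering lifts comparison"` (8: AhmadiEtAl2014,
doi:10.1016/j.nahs.2022.101237, doi:10.1109/cdc57313.2025.11312012, AthanasopoulosJungers2019 —
template ordering, no proof systems); `lit search --source crossref "joint spectral radius NP-hard
Tsitsiklis Blondel Lyapunov function certificate complexity"` (10: TsitsiklisBlondel1997,
Blondel–Gaubert–Tsitsiklis 2000 max-algebra, Blondel–Tsitsiklis survey 2000); `lit search --source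
crossref "tropical proof systems …"` and `"MaxSAT resolution … dual rail"` (nearest proof-complexity
relatives of max-of-linear lines: doi:10.1609/aaai.v32i1.12204, doi:10.1007/978-3-030-51825-7_16 —
different line language, no dynamics); `lit frontier PneNP --since 2022` (30 rows, none on switched
systems); `lit bridges PneNP --cross any` (30 rows, none); hybrid/galaxy/openalex/arXiv endpoints
returned rc 75/429 during the session (logged in NOTES.md); `ledger negatives --problem PneNP` (3,
unrelated).
Nearest prior art found: TsitsiklisBlondel19  [refs: 10.1016/j.nahs.2022.101237, 10.1109/cdc57313.2025.11312012, 10.1609/aaai.v32i1.12204, 10.1007/978-3-030-51825-7_16, doi:10.1016/j.nahs.2022.101237, doi:10.1109/cdc57313.2025.11312012, doi:10.1609/aaai.v32i1.12204, doi:10.1007/978-3-030-51825-7_16, AhmadiJungers2016, MasonShorten2007, AhmadiEtAl2014, AthanasopoulosJungers2019, TsitsiklisBlondel1997]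

Barriers (technique_class: proof-complexity, convex-certificates, switched-systems): - technique_class: proof-complexity, convex-certificates, switched-systems
- Literature.Barriers.PneNP.FeasibleInterpolationEF: not the engine — the rungs are bottleneck
counting / integrality-of-multipliers arguments for an LP-verifiable system far below Frege;
conceded that, like every proof-length ladder, nothing here reaches Frege/EF and the top of the
ladder is X itself with no mechanism; the bet is that a foreign certificate hierarchy with converse
theorems and a template ordering yields new rungs and possibly upper-bound surprises.
- Literature.Barriers.PneNP.Relativization: statements are about explicit linear maps and finite
certificates, no oracle simulation; not applicable to the rungs; conceded for X as for every NP ≠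
coNP route (Literature.Barriers.PneNP.Algebrization, Literature.Barriers.PneNP.BoundedRelativization
likewise).
- Literature.Barriers.PneNP.NaturalProofs: no circuit lower bound and no large/constructive property
of Boolean functions is used; not applicable.
- Literature.Barriers.PneNP.TSPExtensionComplexity: related in spirit (polyhedral certificates of a
combinatorial fact) but neither implies the other: a Lyapunov polytope certifies contraction of a
dynamics, not a lift of a hull; rank 3's intended proof is Haken-type, not a nonnegative-rank bound.
- Negatives index: TwoTonesFrustrationGap, BavardGapPlantedGenusPseudorandom,
ORIncompressibilityNoTC0CompressionSAT — unrelated mechanisms; their lesson (degenerate parameters)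
is respected: c^n floors

History (route lifecycle, newest last):
- 2026-08-15T16:28:10Z · rev 2: restated PathCompletePHPLowerBound (stmt-PneNP-10247 refuted), LayeredCertToResolution (stmt-PneNP-10246), OrderedResolutionUpperBound (stmt-PneNP-10252) — repair: PathCompletePHPLowerBound (stmt-PneNP-10247) refuted-misstated by Summit.PneNP.PneNP.Theorems.LyapunovRefutationsPathCompletePHPLowerBound_refuted (l (planner-rrefute-PneNP-LyapunovRefutations-stmt-a10f8555-0)
- 2026-08-15T16:28:11Z · REPAIRED (restate PathCompletePHPLowerBound, LayeredCertToResolution, OrderedResolutionUpperBound) — back to open: repair: PathCompletePHPLowerBound (stmt-PneNP-10247) refuted-misstated by Summit.PneNP.PneNP.Theorems.LyapunovRefutationsPathCompletePHPLowerBound_refuted (look (planner-rrefute-PneNP-LyapunovRefutations-stmt-a10f8555-0)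
- 2026-08-16T02:18:34Z · rev 4: restated Assembly (stmt-PneNP-10253) — route-repair (ground-failed): restate Assembly (stmt-PneNP-10253), flagged ground.trivial/tauto on the 2026-08-16T02:10Z ground run — with TautBridge := (¬HasPo (planner-rground-PneNP-LyapunovRefutations-c09140c8-0)
- 2026-08-16T04:14:21Z · AUTO-CRUX (backfill): NoPolyBoundedTautProofs — hypotheses of the deciding theorem that nothing in the route derives are cruxes (operator:999:1085951)
- 2026-08-16T09:14:38Z · rev 6: dropped TautBridge — route-repair (cone, step 2/2): RE-ROUTED AROUND the 4 unproved cone facts. New deciding theorem `closes (h0 : NoPolyBoundedTautProofs) : PneNP` proved in-file o (planner-rrepair-PneNP-LyapunovRefutations-c09140c8-0)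
- 2026-08-16T09:16:26Z · rev 8: restated Assembly (stmt-PneNP-14057) — cone repair follow-up: Assembly meaning UNCHANGED (NoPolyBoundedTautProofs → _root_.PneNP, root-qualified like closes); informal gloss updated so provers close (planner-rrepair-PneNP-LyapunovRefutations-c09140c8-0)
- 2026-08-23T06:17:25Z · DORMANT — reconciler: no traction for 5.9 d (last activity statement-grounded at 2026-08-17T07:03:06Z); parked, not closed — `ledger route dormant route-PneNP-LyapunovRef (operator:999:2918207)
- 2026-08-31T19:35:16Z · REACTIVATED (open) — reconciler: reactivated — activity statement-checked at 2026-08-31T18:52:19Z after parking at 2026-08-23T06:17:25Z (operator:999:851003)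

sub-problem: PneNP · status: open · opened planner-plancard-PneNP-PneNP-lyapunov-refutat-05c74de1-0 2026-08-15T15:47:00Z · rev 9 · ledger route-PneNP-LyapunovRefutations
GENERATED by the gate from the ledger (D-0016/17). Provers cite these decls: `theorem foo : Summit.PneNP.PneNP.Theses.LyapunovRefutations.<Decl> := …` in Summits/PneNP/PneNP/Theorems/<Name>.lean.
-/

namespace Summit.PneNP.PneNP.Theses.LyapunovRefutations

open scoped BigOperators Topology Manifold Classical MeasureTheory ProbabilityTheory Matrix InnerProductSpace ComplexConjugate ContinuousMap
open Filter Set Function TopologicalSpace MeasureTheory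

attribute [summit_statement] _root_.PneNP

open Literature.PNP

/-! Retired items kept as plain definitions (history; not obligations of this route): landed proofs / closed glue still name them. -/

/-- retired stmt-PneNP-10249 (dropped, gen None) — proved by Summit.PneNP.PneNP.Theorems.tautBridge_proof @ d852aa9184c8. -/
def TautBridge : Prop :=
  ¬ Literature.Computability.MetaComplexity.HasPolyBoundedProofSystem Literature.Computability.Complexity.TAUT → PneNP

/-- item stmt-PneNP-0097 · crux (kind.auto-crux: conjecture-grade) · rank 0 · open · by planner
why it might fail: X <-> NP != coNP (Cook-Reckhow): false iff SOME proof system, however unnatural, is p-bounded; no superpolynomial lower bound is known for any system from Frege up (Krajicek 2019 Problem 1.5.3); the route's rungs do not imply X.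
sources: CookReckhow1979 (fact Literature.Computability.Complexity.NP_eq_coNP_iff_hasPolyBoundedProofSystem_TAUT), KrajicekProofComplexity2019 Problem 1.5.3, book:krajicek1995-bounded-arithmetic-propositional-logic-complexity-theory p.27 Thm 4.1.2
No Cook–Reckhow proof system for TAUT is polynomially bounded; equivalently NP ≠ coNP
[CookReckhow1979, Prop. 1.1]. Route thesis of PneNP/ProofCplx. [sources: CookReckhow1979;
arXiv:2208.11642] -/
@[route_item "route-PneNP-LyapunovRefutations", crux]
def NoPolyBoundedTautProofs : Prop :=
  ¬ Literature.Computability.MetaComplexity.HasPolyBoundedProofSystem Literature.Computability.Complexity.TAUT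

/-- item stmt-PneNP-10888 · crux · rank 2 · open · by planner
why it might fail: Even with nonnegative pieces a node is a covering state (a SET of candidate falsified clauses, a DNF-like line): natural simulation is Res(k), k = O(1) unclear; signed pieces may add Sherali–Adams counting (AtseriasLauria2018 Thm 7/9), then PHP kills the item via haken_pigeonhole_holds.
sources: KrajicekProofComplexity2019, Haken1985, AhmadiEtAl2014, AtseriasLauria2018, Jukna2012
[crux] repaired LayeredCertToResolution (stmt-PneNP-10246: refutable as typed by the same column
certificate + haken_pigeonhole_holds; superseded in the repair of stmt-PneNP-10247). LOCATE THE
FORWARD-COMPLETE POLYHEDRAL CLASS (card K1b): there is k such that every forward-complete layered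
max-linear certificate (N, P) of a CNF φ — root 0 < N 0, forward-completeness with max-domination on
the orthant (every node has a b-successor for each letter b), leaf condition (L2), root condition
(L3) — yields a resolution refutation of φ of length ≤ (Σ pieces + size φ + |φ| + 2)^k. I.e.
fractional pieces on an ordered read-once deterministic skeleton buy at most a polynomial over
regular / ordered resolution; then every resolution lower bound in the tree (haken_pigeonhole_holds;
Tseitin, random k-CNF) becomes a lower bound on forward-complete polyhedral Lyapunov certificates of
Tsitsiklis–Blondel pairs. Under forward-completeness + (L2) every node is non-empty, so pieces ≥
nodes and the size measure is honest. [difficulty: L] -/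
@[route_item "route-PneNP-LyapunovRefutations"]
def LayeredCertToResolutionFC : Prop :=
  ∃ k : ℕ, ∀ (φ : Literature.Computability.Complexity.CNF ℕ) (N : ℕ → ℕ) (P : ℕ → ℕ → List (ℚ × (Fin φ.length → ℚ))), (0 < N 0 ∧ (∀ j < φ.numVars, ∀ v < N j, ∀ b : Bool, ∃ v' < N (j + 1), ∀ x : ℚ × (Fin φ.length → ℚ), 0 ≤ x.1 → (∀ i, 0 ≤ x.2 i) → ∀ q' ∈ P (j + 1) v', ∃ q ∈ P j v, q'.1 * (x.1 + ∑ i, if ((j, b) : ℕ × Bool) ∈ φ[i] then x.2 i else 0) + (∑ i, q'.2 i * (if ((j, b) : ℕ × Bool) ∈ φ[i] then 0 else x.2 i)) ≤ q.1 * x.1 + ∑ i, q.2 i * x.2 i) ∧ (∀ v < N φ.numVars, ∀ x : ℚ × (Fin φ.length → ℚ), 0 ≤ x.1 → (∀ i, 0 ≤ x.2 i) → ∃ q ∈ P φ.numVars v, x.1 ≤ q.1 * x.1 + ∑ i, q.2 i * x.2 i) ∧ (∀ v < N 0, ∀ q ∈ P 0 v, (∑ i, q.2 i) < (φ.length : ℚ)))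 → ∃ π : List (Literature.Computability.MetaComplexity.ResLine ℕ), Literature.Computability.MetaComplexity.IsResRefutation φ π ∧ π.length ≤ ((∑ j ∈ Finset.range (φ.numVars + 1), ∑ v ∈ Finset.range (N j), (P j v).length) + φ.size + φ.length + 2) ^ k

/-- item stmt-PneNP-10887 · crux · rank 3 · open · by planner
why it might fail: Signed rational pieces with convex domination may count: PHP^(n+1)_n has poly-size circular-resolution ≡ Sherali–Adams refutations (AtseriasLauria2018 Thm 9, Thm 7); a read-once layering of that flow proof in the order x_(ij)=i·n+j as node potentials gives poly(n) certificates and kills the item.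
sources: Haken1985, AhmadiEtAl2014, AtseriasLauria2018, TsitsiklisBlondel1997, Jukna2012
[crux] repaired PathCompletePHPLowerBound (stmt-PneNP-10247, refuted-misstated by
Summit.PneNP.PneNP.Theorems.LyapunovRefutationsPathCompletePHPLowerBound_refuted: the look-ahead
path clause `∀ w, ∃ p` admitted the data-free m-node column certificate for every unsatisfiable
CNF). FIRST BOOLEAN-REGIME LOWER BOUND for FORWARD-COMPLETE certificates (AhmadiEtAl2014 Prop. 3.3
(i) / Cor. 3.4, the checkable sufficient condition for path-completeness): a root exists (0 < N 0)
and EVERY node v < N j at layer j < numVars has, for EACH letter b, a b-successor v' < N (j+1) each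
of whose pieces pulled back by T_(j,b) is dominated on the nonnegative orthant by the max of the
pieces of v (∀ x ∀ q' ∃ q); leaf (L2) and root (L3) conditions unchanged. Claim: there is c > 1 such
that for every n every forward-complete layered max-linear certificate for PHP^(n+1)_n
(pigeonholeCNF (n+1) n, canonical order x_(ij) = i·n + j) has total piece count Σ_j Σ_(v<N j) |P j
v| ≥ c^n. WLOG the skeleton is deterministic (keep one successor per letter) = an ordered read-once
branching program whose nodes carry max-linear potentials, and by backward induction every node
majorises the Bellman value function of its lay -/
@[route_item "route-PneNP-LyapunovRefutations"]
def PathCompletePHPLowerBoundFC : Prop :=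
  ∃ c : ℝ, 1 < c ∧ ∀ (n : ℕ) (N : ℕ → ℕ) (P : ℕ → ℕ → List (ℚ × (Fin (Literature.Computability.MetaComplexity.pigeonholeCNF (n + 1) n).length → ℚ))), (0 < N 0 ∧ (∀ j < (Literature.Computability.MetaComplexity.pigeonholeCNF (n + 1) n).numVars, ∀ v < N j, ∀ b : Bool, ∃ v' < N (j + 1), ∀ x : ℚ × (Fin (Literature.Computability.MetaComplexity.pigeonholeCNF (n + 1) n).length → ℚ), 0 ≤ x.1 → (∀ i, 0 ≤ x.2 i) → ∀ q' ∈ P (j + 1) v', ∃ q ∈ P j v, q'.1 * (x.1 + ∑ i, if ((j, b) : ℕ × Bool) ∈ (Literature.Computability.MetaComplexity.pigeonholeCNF (n + 1) n)[i] then x.2 i else 0) + (∑ i, q'.2 i * (if ((j, b) : ℕ × Bool) ∈ (Literature.Computability.MetaComplexity.pigeonholeCNF (n + 1) n)[i] then 0 else x.2 i)) ≤ q.1 * x.1 + ∑ i, q.2 i * x.2 i) ∧ (∀ v < N (Literature.Computability.MetaComplexity.pigeonholeCNF (n + 1) n).numVars, ∀ x : ℚ × (Fin (Literature.Computability.MetaComplexity.pigeonholeCNF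 (n + 1) n).length → ℚ), 0 ≤ x.1 → (∀ i, 0 ≤ x.2 i) → ∃ q ∈ P (Literature.Computability.MetaComplexity.pigeonholeCNF (n + 1) n).numVars v, x.1 ≤ q.1 * x.1 + ∑ i, q.2 i * x.2 i) ∧ (∀ v < N 0, ∀ q ∈ P 0 v, (∑ i, q.2 i) < ((Literature.Computability.MetaComplexity.pigeonholeCNF (n + 1) n).length : ℚ))) → c ^ n ≤ ((∑ j ∈ Finset.range ((Literature.Computability.MetaComplexity.pigeonholeCNF (n + 1) n).numVars + 1), ∑ v ∈ Finset.range (N j), (P j v).length : ℕ) : ℝ)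

/-- item stmt-PneNP-10248 · crux · rank 4 · open · by planner
why it might fail: Not hit by the column certificate (one node takes both transitions). If all sigma-coefficients are 1 the supports {i: c_i<1} give a read-once BP for Search(PHP), so Haken yields c^n; open: pieces with a != 1 or negative entries (domination may raise a) could give a fractional poly(n) certificate.
sources: Haken1985 (haken_pigeonhole_holds), doi:10.1007/978-3-642-24508-4 S18.2 Thm 18.1 (Jukna 2012), doi:10.1016/0166-218x(87)90039-4 (Cook-Coullard-Turan 1987: poly-size cutting-planes PHP), MasonShorten2007
[crux] COMMON POLYHEDRAL LYAPUNOV FUNCTIONS (one node per layer = a single max-of-linear copositive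
Lyapunov function of the TB pair, MasonShorten2007 / Molchanov–Pyatnitskiy class): there is c > 1
such that every one-node-per-layer layered max-linear certificate for PHP^(n+1)_n has ≥ c^n pieces.
Special case of rank 3 (N ≡ 1); the cheapest genuine rung: in this class integral pieces 𝟙 − e_C
only refute CNFs containing the empty clause, so the content is exactly what fractional pieces can
do without branching memory. [difficulty: M] -/
@[route_item "route-PneNP-LyapunovRefutations"]
def CommonLyapunovPHPLowerBound : Prop :=
  ∃ c : ℝ, 1 < c ∧ ∀ (n : ℕ) (P : ℕ → List (ℚ × (Fin (Literature.Computability.MetaComplexity.pigeonholeCNF (n + 1) n).length → ℚ))), ((∀ j < (Literature.Computability.MetaComplexity.pigeonholeCNF (n + 1) n).numVars, ∀ b : Bool, ∀ x : ℚ × (Fin (Literature.Computability.MetaComplexity.pigeonholeCNF (n + 1) n).length → ℚ), 0 ≤ x.1 → (∀ i, 0 ≤ x.2 i) → ∀ q' ∈ P (j + 1), ∃ q ∈ P j, q'.1 * (x.1 + ∑ i, if ((j, b) : ℕ × Bool) ∈ (Literature.Computability.MetaComplexity.pigeonholeCNF (n + 1) n)[i] then x.2 i else 0) + (∑ i, q'.2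 i * (if ((j, b) : ℕ × Bool) ∈ (Literature.Computability.MetaComplexity.pigeonholeCNF (n + 1) n)[i] then 0 else x.2 i)) ≤ q.1 * x.1 + ∑ i, q.2 i * x.2 i) ∧ (∀ x : ℚ × (Fin (Literature.Computability.MetaComplexity.pigeonholeCNF (n + 1) n).length → ℚ), 0 ≤ x.1 → (∀ i, 0 ≤ x.2 i) → ∃ q ∈ P (Literature.Computability.MetaComplexity.pigeonholeCNF (n + 1) n).numVars, x.1 ≤ q.1 * x.1 + ∑ i, q.2 i * x.2 i) ∧ (∀ q ∈ P 0, (∑ i, q.2 i) < ((Literature.Computability.MetaComplexity.pigeonholeCNF (n + 1) n).length : ℚ))) → c ^ n ≤ ((∑ j ∈ Finset.range ((Literature.Computability.MetaComplexity.pigeonholeCNF (n + 1) n).numVars + 1), (P j).length : ℕ) : ℝ)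

-- item stmt-PneNP-10263 · crux · rank 5 · open · by planner — informal only, no Lean statement yet:
--   [crux] THE SPECTRAL RUNG (card K3). For the Tsitsiklis–Blondel pair (A₀(φ_n), A₁(φ_n))
--   (TsitsiklisBlondel1997 §2; definition request D1) of φ_n = random 3-XOR at constant clause density
--   (or Tseitin on bounded-degree expanders) with n variables and m = Θ(n) clauses, every SOS-Lyapunov
--   certificate of UNSAT — a form p of degree 2d with p − ε‖x‖^{2d} SOS and γ^{2d}·p(x) − p(A_b x) SOS
--   for b = 0,1, where γ^{n+2} < m (Parrilo–Jadbabaie LAA 2008 class; definition request D2) — has d ≥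
--   n^{δ} for some absolute δ > 0 and all large n. Intended proof: build the dual witness directly — a
--   pseudo-invariant (

/-- item stmt-PneNP-14054 · crux · rank 6 · open · by planner
why it might fail: Alive clause tokens at a vertex linearly encode its read edge values and piece magnitudes are free, so poly(n) signed forms per layer might majorise the parity Bellman loss F+[F even] without a 2^n-wide skeleton; statics give no bound even for N≡1, and no SA-size bound is known for GRID Tseitin.
sources: Urquhart1987, DantchevRiis2001, KrajicekProofComplexity2019, AhmadiEtAl2014, AtseriasLauria2018, DadushTiwari2020
[crux] THE PARITY RUNG (added at the route-choice of 2026-08-16, after the substantive refutation of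
the look-ahead PHP rung PathCompletePHPLowerBound and the refuters' located counting lead against
the forward-complete PHP rungs 2–4 — rattack-10888: fractional compression of the PHP Bellman
targets at the boundary layers by 4n+2 resp. 13n+3 signed lines, verified n ≤ 6; AtseriasLauria2018
poly-size circular-resolution/Sherali–Adams PHP): for every n ≥ 2, every FORWARD-COMPLETE layered
max-linear certificate (root 0 < N 0; for every node and each letter a successor whose pieces pulled
back by T_(j,b) are max-dominated on the orthant; leaf (L2); root (L3) — the verbatim hypothesis
block of LayeredCertToResolutionFC) of the Tseitin contradiction tseitinCNF(T_n, χ₀) of the explicit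
n × n TORUS T_n on Fin (n·n) (vertex p ↦ (p / n, p % n), edges to (r, c±1 mod n) and (r±1 mod n, c),
given as SimpleGraph.fromRel of that arithmetic relation; 4-regular for n ≥ 3, C₄ at n = 2) with the
odd charge χ₀ = [vertex 0] (unsatisfiable: tseitinCNF_not_satisfiable_holds), edge variables
numbered by tseitinEdgeVar and read in index order (unused indices are identity layers), has total
piece count Σ_j -/
@[route_item "route-PneNP-LyapunovRefutations"]
def PathCompleteTseitinLowerBoundFC : Prop :=
  ∃ c : ℝ, 1 < c ∧ ∀ (n : ℕ), 2 ≤ n → ∀ (φ : Literature.Computability.Complexity.CNF ℕ), φ = Literature.Computability.MetaComplexity.tseitinCNF (SimpleGraph.fromRel fun p q : Fin (n * n) => ((p : ℕ) / n = (q : ℕ) / n ∧ ((p : ℕ) % n + 1) % n = (q : ℕ) % n) ∨ ((p : ℕ) % n = (q : ℕ) % n ∧ ((p : ℕ) / n + 1) % n = (q : ℕ) / n)) (fun u : Fin (n * n) => decide ((u : ℕ) = 0)) → ∀ (N : ℕ → ℕ) (P : ℕ → ℕ → List (ℚ × (Fin φ.length → ℚ))), (0 < N 0 ∧ (∀ j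 < φ.numVars, ∀ v < N j, ∀ b : Bool, ∃ v' < N (j + 1), ∀ x : ℚ × (Fin φ.length → ℚ), 0 ≤ x.1 → (∀ i, 0 ≤ x.2 i) → ∀ q' ∈ P (j + 1) v', ∃ q ∈ P j v, q'.1 * (x.1 + ∑ i, if ((j, b) : ℕ × Bool) ∈ φ[i] then x.2 i else 0) + (∑ i, q'.2 i * (if ((j, b) : ℕ × Bool) ∈ φ[i] then 0 else x.2 i)) ≤ q.1 * x.1 + ∑ i, q.2 i * x.2 i) ∧ (∀ v < N φ.numVars, ∀ x : ℚ × (Fin φ.length → ℚ), 0 ≤ x.1 → (∀ i, 0 ≤ x.2 i) → ∃ q ∈ P φ.numVars v, x.1 ≤ q.1 * x.1 + ∑ i, q.2 i * x.2 i) ∧ (∀ v < N 0, ∀ q ∈ P 0 v, (∑ i, q.2 i) < (φ.length : ℚ))) → c ^ n ≤ ((∑ j ∈ Finset.range (φ.numVars + 1), ∑ v ∈ Finset.range (N j), (P j v).length : ℕ) : ℝ)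

/-- item stmt-PneNP-10250 · support · rank 9 · closed · proved by Summit.PneNP.PneNP.Theorems.lyapunovRefutations_layeredCertSound_proof @ 23bea30ca85a (prover) · by planner
sources: TsitsiklisBlondel1997, AhmadiEtAl2014
[support] SOUNDNESS (card P1, the Lyapunov ⇒ stable ⇒ UNSAT direction, made matrix-free): a layered
max-linear certificate of φ exists only if φ is unsatisfiable. Proof: run the satisfying word from
(0, 𝟙); at layer n = φ.numVars the state is (m, 0); (L2) gives a leaf piece ≥ m there, (PC+L1) pulls
it back to a root piece ≥ m at (0, 𝟙), contradicting (L3). [difficulty: provable-now] -/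
@[route_item "route-PneNP-LyapunovRefutations"]
def LayeredCertSound : Prop :=
  ∀ (φ : Literature.Computability.Complexity.CNF ℕ) (N : ℕ → ℕ) (P : ℕ → ℕ → List (ℚ × (Fin φ.length → ℚ))), ((∀ w : ℕ → Bool, ∃ p : ℕ → ℕ, (∀ j ≤ φ.numVars, p j < N j) ∧ ∀ j < φ.numVars, ∀ x : ℚ × (Fin φ.length → ℚ), 0 ≤ x.1 → (∀ i, 0 ≤ x.2 i) → ∀ q' ∈ P (j + 1) (p (j + 1)), ∃ q ∈ P j (p j), q'.1 * (x.1 + ∑ i, if ((j, w j) : ℕ × Bool) ∈ φ[i] then x.2 i else 0) + (∑ i, q'.2 i * (if ((j, w j) : ℕ × Bool) ∈ φ[i] then 0 else x.2 i)) ≤ q.1 * x.1 + ∑ i, q.2 i * x.2 i) ∧ (∀ v < N φ.numVars, ∀ x : ℚ × (Fin φ.length → ℚ), 0 ≤ x.1 → (∀ i, 0 ≤ x.2 i) → ∃ q ∈ P φ.numVars v, x.1 ≤ q.1 * x.1 + ∑ i, q.2 i * x.2 i) ∧ (∀ v < N 0, ∀ q ∈ P 0 v, (∑ i, q.2 i)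 < (φ.length : ℚ))) → ¬ φ.Satisfiable

-- `LayeredCertSound` holds: proved by `Summit.PneNP.PneNP.Theorems.lyapunovRefutations_layeredCertSound_proof` @ 23bea30ca85a (its module imports this route file, so no `_holds` link can be stated here).

/-- item stmt-PneNP-10251 · support · rank 9 · closed · proved by Summit.PneNP.PneNP.Theorems.lyapunovRefutations_layeredCertComplete_proof @ 4586f12d4cca (prover) · by planner
sources: TsitsiklisBlondel1997, AhmadiEtAl2014
[support] COMPLETENESS (converse Lyapunov theorem in this class; card P1): every unsatisfiable φ has
a layered max-linear certificate — one node per layer, pieces (1, w^β) with w^β_i = [clause i is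
satisfied by β on the variables ≥ j], β ranging over assignments of the unread variables (≤ 2^m
distinct pieces per layer); this is TB's brute-force 'all 2^(n+2) products contract' certificate.
Guards every rung against vacuity. [difficulty: provable-now] -/
@[route_item "route-PneNP-LyapunovRefutations"]
def LayeredCertComplete : Prop :=
  ∀ (φ : Literature.Computability.Complexity.CNF ℕ), ¬ φ.Satisfiable → ∃ (N : ℕ → ℕ) (P : ℕ → ℕ → List (ℚ × (Fin φ.length → ℚ))), (∀ w : ℕ → Bool, ∃ p : ℕ → ℕ, (∀ j ≤ φ.numVars, p j < N j) ∧ ∀ j < φ.numVars, ∀ x : ℚ × (Fin φ.length → ℚ), 0 ≤ x.1 → (∀ i, 0 ≤ x.2 i) → ∀ q' ∈ P (j + 1) (p (j + 1)), ∃ q ∈ P j (p j), q'.1 * (x.1 + ∑ i, if ((j, w j) : ℕ × Bool) ∈ φ[i] then x.2 i else 0) + (∑ i, q'.2 i * (if ((j, w j) : ℕ × Bool) ∈ φ[i] then 0 else x.2 i)) ≤ q.1 * x.1 + ∑ i, q.2 i * x.2 i) ∧ (∀ v < N φ.numVars, ∀ x : ℚ × (Fin φ.length → ℚ), 0 ≤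 x.1 → (∀ i, 0 ≤ x.2 i) → ∃ q ∈ P φ.numVars v, x.1 ≤ q.1 * x.1 + ∑ i, q.2 i * x.2 i) ∧ (∀ v < N 0, ∀ q ∈ P 0 v, (∑ i, q.2 i) < (φ.length : ℚ))

-- `LayeredCertComplete` holds: proved by `Summit.PneNP.PneNP.Theorems.lyapunovRefutations_layeredCertComplete_proof` @ 4586f12d4cca (its module imports this route file, so no `_holds` link can be stated here).

-- item stmt-PneNP-10264 · support · rank 9 · open · by planner — informal only, no Lean statement yet:
--   [support] THE MATRIX LINK (card D1/P1; ties the typed rungs to actual Lyapunov functions). Let (A₀,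
--   A₁) be the Tsitsiklis–Blondel pair of a CNF φ with n = numVars variables and m clauses
--   (TsitsiklisBlondel1997 §2: states s, u_{ij} (clause i, variable j), u_{0j}, u_{i,n+1}; in G_b the
--   edge u_{ij} → u_{0j} iff the literal (x_j, b) lies in C_i, else u_{ij} → u_{i,j+1}; s → u_{i1};
--   u_{0j} → u_{0,j+1}; u_{0n} → s; definition request D1). (a) RESTRICTION: every path-complete graph
--   Lyapunov function (AhmadiEtAl2014 Def. 2.2, single-letter labels) with N nodes whose node functions
--   are polyhedral and c

/-- item stmt-PneNP-10889 · support · rank 9 · open · by planner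
sources: KrajicekProofComplexity2019, Haken1985, Jukna2012, AhmadiEtAl2014
[support] repaired OrderedResolutionUpperBound (stmt-PneNP-10252: true but made contentless by the
column certificate of the look-ahead class). ORDERED RESOLUTION EMBEDS INTO THE FORWARD-COMPLETE
CLASS (card K1a): a resolution refutation π of φ whose pivots strictly increase along every
conclusion-to-premise dag path (= an ordered read-once branching program for clause search reading
x_0 first) yields a FORWARD-COMPLETE layered max-linear certificate (root, every node a b-successor
for each b with max-domination, L2, L3) with ≤ (|π|+1)(numVars+1)(m+1) pieces: node = line D at
layer pivot(D) with copies on the skipped layers (both letters lead a copy to the next copy), the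
b-successor of D is the premise containing the literal (pivot(D), ¬b), initial clauses continue by
copies to layer numVars, weakening lines are contracted onto their premise; pieces (1, 𝟙 − e_C) for
the initial clauses C below D (root sum m − 1 < m, leaf value ≥ σ); domination holds because every
variable of a leaf C below D is a pivot on every root-to-C path, so C avoids the variables strictly
between a parent's pivot and pivot(D), and a leaf below the b-premise of a pivot-x_j step never
contains the literal (j,b -/
@[route_item "route-PneNP-LyapunovRefutations"]
def OrderedResolutionUpperBoundFC : Prop :=
  ∀ (φ : Literature.Computability.Complexity.CNF ℕ) (π : List (Literature.Computability.MetaComplexity.ResLine ℕ)), Literature.Computability.MetaComplexity.IsResRefutation φ π → (∀ p, Literature.Computability.MetaComplexity.IsDagPath (π.map Literature.Computability.MetaComplexity.ResLine.premises) p → (Literature.Computability.MetaComplexity.pivotsAlong π p).Pairwise (· < ·)) → ∃ (N : ℕ → ℕ) (P : ℕ → ℕ → List (ℚ × (Fin φ.length → ℚ))), (0 < N 0 ∧ (∀ j < φ.numVars, ∀ v < N j, ∀ b : Bool, ∃ v' < N (j + 1), ∀ x : ℚ × (Fin φ.length → ℚ), 0 ≤ x.1 → (∀ i, 0 ≤ x.2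 i) → ∀ q' ∈ P (j + 1) v', ∃ q ∈ P j v, q'.1 * (x.1 + ∑ i, if ((j, b) : ℕ × Bool) ∈ φ[i] then x.2 i else 0) + (∑ i, q'.2 i * (if ((j, b) : ℕ × Bool) ∈ φ[i] then 0 else x.2 i)) ≤ q.1 * x.1 + ∑ i, q.2 i * x.2 i) ∧ (∀ v < N φ.numVars, ∀ x : ℚ × (Fin φ.length → ℚ), 0 ≤ x.1 → (∀ i, 0 ≤ x.2 i) → ∃ q ∈ P φ.numVars v, x.1 ≤ q.1 * x.1 + ∑ i, q.2 i * x.2 i) ∧ (∀ v < N 0, ∀ q ∈ P 0 v, (∑ i, q.2 i) < (φ.length : ℚ))) ∧ (∑ j ∈ Finset.range (φ.numVars + 1), ∑ v ∈ Finset.range (N j), (P j v).length) ≤ (π.length + 1) * (φ.numVars + 1) * (φ.length + 1)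

-- earlier Assembly (stmt-PneNP-10253, replaced 2026-08-16T02:18:34Z -> stmt-PneNP-14057): retired by None — NoPolyBoundedTautProofs → TautBridge → PneNP
-- earlier Assembly (stmt-PneNP-14057, replaced 2026-08-16T09:16:26Z -> stmt-PneNP-15155): retired by None — NoPolyBoundedTautProofs → PneNP
/-- item stmt-PneNP-15155 · assembly · rank 1 · closed · proved by Summit.PneNP.PneNP.Theorems.lyapunovRefutations_assembly_proof @ ecd94a231a7d (prover) · by planner
sources: CookReckhow1979, AroraBarakCC2009
[assembly] NoPolyBoundedTautProofs → PneNP: the route's X (no p-bounded Cook–Reckhow proof system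
for TAUT) implies the summit statement. Since the cone repair of 2026-08-16 this is LITERALLY the
type of the route's deciding theorem `Summit.PneNP.PneNP.Theses.LyapunovRefutations.closes` (proved
in the route file over conjecture-free modules: CookBridges.pneNP_shape_of_P_ne_NP,
TAUT_mem_coNP_holds, hasPolyBoundedProofSystem_iff_mem_NP_holds, co_P_holds). PROVE IT AS `theorem …
: Summit.PneNP.PneNP.Theses.LyapunovRefutations.Assembly :=
Summit.PneNP.PneNP.Theses.LyapunovRefutations.closes` in a Theorems file importing ONLY
`Summits.PneNP.PneNP.Theses.LyapunovRefutations` — cone hygiene: do NOT import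
Theorems/ExpanderLinearGeneratorsTautBridge, ClayProblem, NPBridge, ClayProblemProofs or
ProofComplexityNP (each carries an unproved named fact — NPNotSubsetPPoly / EFNotPolyBounded /
MurrayWilliams2018_* — into the route's import cone and de-staffs the route). [difficulty:
provable-now] [CookReckhow1979, AroraBarakCC2009] -/
@[route_item "route-PneNP-LyapunovRefutations"]
def Assembly : Prop :=
  NoPolyBoundedTautProofs → _root_.PneNP

-- `Assembly` holds: proved by `Summit.PneNP.PneNP.Theorems.lyapunovRefutations_assembly_proof` @ ecd94a231a7d (its module imports this route file, so no `_holds` link can be stated here).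

-- records of items no longer active in this route (dropped / restated):
-- earlier LayeredCertToResolution (stmt-PneNP-10246, replaced 2026-08-15T16:28:10Z -> stmt-PneNP-10888): retired by None — ∃ k : ℕ, ∀ (φ : Literature.Computability.Complexity.CNF ℕ) (N : ℕ → ℕ) (P : ℕ → ℕ → List (ℚ × (Fin φ.length → ℚ))), ((∀ w : ℕ → Bool, ∃ p : ℕ → ℕ, (∀ j ≤ φ.numVars, p j < N j) ∧ ∀ j < φ.numVars, ∀ x : ℚ × (Fin φ.length → ℚ), 0 ≤ x.1 → (∀ i, 0 ≤ x.2 i) → ∀ q' ∈ P (j + 1) (p (j + 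
-- earlier PathCompletePHPLowerBound (stmt-PneNP-10247, replaced 2026-08-15T16:28:10Z -> stmt-PneNP-10887): refuted by Summit.PneNP.PneNP.Theorems.LyapunovRefutationsPathCompletePHPLowerBound_refuted @ 26744e34795a — ∃ c : ℝ, 1 < c ∧ ∀ (n : ℕ) (N : ℕ → ℕ) (P : ℕ → ℕ → List (ℚ × (Fin (Literature.Computability.MetaComplexity.pigeonholeCNF (n + 1) n).length → ℚ))), ((∀ w : ℕ → Bool, ∃ p : ℕ → ℕ, (∀ j ≤ 
-- earlier TautBridge (stmt-PneNP-10249, dropped 2026-08-16T09:14:38Z): proved by Summit.PneNP.PneNP.Theorems.tautBridge_proof @ d852aa9184c8 — ¬ Literature.Computability.MetaComplexity.HasPolyBoundedProofSystem Literature.Computability.Complexity.TAUT → PneNP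
-- earlier OrderedResolutionUpperBound (stmt-PneNP-10252, replaced 2026-08-15T16:28:10Z -> stmt-PneNP-10889): retired by None — ∀ (φ : Literature.Computability.Complexity.CNF ℕ) (π : List (Literature.Computability.MetaComplexity.ResLine ℕ)), Literature.Computability.MetaComplexity.IsResRefutation φ π → (∀ p, Literature.Computability.MetaComplexity.IsDagPath (π.map Literature.Computability.MetaComplex

/-! D-0027 §2.1 — DECIDING THEOREM (planner-authored via `route open/edit --closes-file`; by planner-rrepair-PneNP-LyapunovRefutations-c09140c8-0 2026-08-16T09:14:38Z):
its hypotheses are this route's items and its conclusion the sub-problem Statement (glue_lint), and it elaborates with this file. -/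

@[closes "route-PneNP-LyapunovRefutations"] theorem closes (h₀ : NoPolyBoundedTautProofs) : _root_.PneNP := by
  -- Cook–Reckhow (Prop. 1.1/1.4) + the Cook/Wave0 model bridges, over conjecture-free modules only:
  -- if Classes.P = NP then coNP = co P = P = NP (co_P_holds), so TAUT ∈ coNP (TAUT_mem_coNP_holds)
  -- lies in NP and has a polynomially bounded proof system (hasPolyBoundedProofSystem_iff_mem_NP_holds),
  -- contradicting X; and Classes.P ≠ NP is Cook's statement by CookBridges (pneNP_shape_of_P_ne_NP).
  have hne : Literature.Computability.Complexity.Classes.P ≠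
      Literature.Computability.Complexity.Nondeterministic.NP := by
    intro hPNP
    apply h₀
    have hT : Literature.Computability.Complexity.TAUT ∈ Literature.Computability.Complexity.coNP :=
      Literature.Computability.Complexity.TAUT_mem_coNP_holds
    have hco : Literature.Computability.Complexity.coNP =
        Literature.Computability.Complexity.Nondeterministic.NP := by
      show Literature.Computability.Complexity.co Literature.Computability.Complexity.Nondeterministic.NP =
        Literature.Computability.Complexity.Nondeterministic.NP
      rw [← hPNP]
      exact Literature.Computability.Complexity.co_P_holds
    rw [hco] at hT
    exact Literature.Computability.MetaComplexity.hasPolyBoundedProofSystem_iff_mem_NP_holds.2 hT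
  obtain ⟨L, hL, hL'⟩ := Literature.Computability.Complexity.pneNP_shape_of_P_ne_NP hne
  exact ⟨L, hL, hL'⟩

end Summit.PneNP.PneNP.Theses.LyapunovRefutations
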